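import Summits.Parity.GeneralizedHardyLittlewood.Theorems.PrimeLevelFamEdgeIdeaDeltasFloorDualQuarter
import HarnessLib

/-!
# Route `PrimeLevelFamEdge` — TYPED IDEA DELTAS, deck 18j: K-L21-8 — THE KLS WINDOW HIERARCHY FOR THE AH¼ WITNESS
# (lever (L-c) of K-L21-3; conjecture N-L21-2 = `QuarterWitnessRealisable`).  Cell ls-idea, seat ls-idea-lens-21 gen 6
# (`barrier` lens × CI-GAPS), card v8.0 7bf1c532b04f53ea; critic F's pre-registered protocol b30.6 (M1)–(M7) answered by the seat;
# critic of record E (ref-5) b20: PASS-COMPUTED (cut soundness read, F's frozen checker re-run on mix_32/mix_160).  LANDING NOTE typer ls-idea-typ-1 gen 4: the seat's `g6/Sketch_L21_KLSWindow.lean` sha16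
# fc80e0712105b53b VERBATIM (already in the deck namespace `.FloorDual`, imports deck 18d `…FloorDualQuarter`) up to this header and
# `yamada_pointwise` made `private` (dedup: = `Literature.InformationTheory.QuantumCodes.consecutive_root_product_nonneg`).

The realisability conjunct `KLSRealisable (1/2) quarterRho` of `QuarterWitnessRealisable` (deck 18b) is a statement about a
point process on `ℝ`; because `quarterRho` is carried by `¼ℤ` it is a statement about a STATIONARY HARD-CORE 0/1 PROCESS on the
quarter-lattice (density `¼` per site, no two adjacent sites occupied, `P(η₀ = η_k = 1) = c_k/4`).  Such a process exists iff for
every window of `n+1` consecutive sites there is a STATIONARY WINDOW LAW with these one- and two-site statistics (necessity: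
restriction; sufficiency: compactness + the Markov extension of a consistent window law) — the finite LP hierarchy of gen 2
(`l21g2_realize.py`, feasible for `n+1 ≤ 18`).  This deck TYPES the hierarchy and its two certificate shapes:

* `IsWindowLaw`, `WindowRealisable`, `QuarterWindowRealisable n` — the window-`(n+1)` LP as a `Prop`;
* `PeriodicMixture` / `MixtureRealises` — the FEASIBILITY certificate: the stationary window laws are exactly the mixtures of
  uniformly shifted PERIODIC hard-core words (normalised circulations of the hard-core de Bruijn graph = convex hull of its simple
  cycles), so a window is certified feasible by finitely many words with weights;
* `WindowCut` / `cutRefutes` (PROVED) — the INFEASIBILITY certificate: a Farkas functional `y₀ + y_ρ ρ + Σ y_k p_k` that is `≤ 0` in mean on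
  every cycle, certified EDGE-WISE by a node potential `φ` (max-mean-cycle duality); summed against a window law the potential
  telescopes by stationarity — this is literally a Kuna–Lebowitz–Speer quadratic test polynomial, i.e. the shape of the cell's first
  BEYOND-PAIR certificate if AH¼ were not realisable;
* `yamada_pointwise` (PROVED) + `countVar` / `YamadaCondition` — Yamada's 1961 integrality condition `Var S_N ≥ {E S_N}(1 − {E S_N})`
  as the KLS polynomial `(S_N − m)(S_N − m − 1) ≥ 0`, linear in `(ρ, p)`.

COMPUTED CLAIMS OF RECORD (gen 6; `g6/cg_hull.py` = EXACT column generation over periodic words: master LP + Howard max-mean-cycle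
pricing on the hard-core de Bruijn graph with `F(n+2)` edges, certified both ways, reach n ≤ 32 sites; `g6/cg_heur.py` = HEURISTIC column generation
(NNLS master + simulated-annealing word oracle, feasibility certificates only), reach n ≤ 160 sites; every shipped mixture re-checked in exact
rational arithmetic by `g6/check_ship.py`; numbers in `L21-KLS-OUTPUTS.md`; computed ≠ proved):
(W160) `QuarterWindow160`: AH¼ is window-realisable for every window up to `160` quarter-sites = `40` mean spacings (gen 2 reach: `18` = `4.5`),
  with explicit mixtures of ≤ 160 periodic hard-core words (periods ≤ 538; sup-norm residual ≤ 1.2e-15) and ROBUSTLY: at n = 40, 64, 96, 128, 160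
  the point `u + 2(t − u)` beyond AH¼ on the segment from the realisable embedded AH process `u` is itself window-feasible, so `t` is interior
  with margin `|t − u|_∞ ≈ 0.03 ≫` residual, and smaller windows inherit feasibility by restriction; n = 192, 200 undecided here (heuristic
  oracle residual 1e-5, still decreasing);
(Y) `QuarterPassesYamada` holds for every `N ≤ 4000` (closed form, float): `Var_t S_2 = ¼` (the hard-core identity, margin `0`, no violation),
  least margin `0.1067` at `N = 6`, and `Var_t S_N = 0.10132 log N + 0.1742` fitted over `40 < N ≤ 4000`, `N ≡ 2 (4)` (`1/π² = 0.10132`), so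
  the Yamada family NEVER refutes AH¼;
(R) radial depth of `t` in the window hull along the ray from the density-¼ hard-core Markov chain (exact CG): `s*(N) = 1.386, 1.263, 1.204, 1.168,
  1.144, 1.127, 1.114` at `N = 8, 12, …, 32` (pairs `N ≡ 2, 0 (4)` agree) — the binding facet is EXACTLY Yamada's polynomial at `N ≡ 2 (4)`,
  `m = (N−2)/4` (dual vectors agree to 8e-16), so `s* = 1 + (Var_t S_N − ¼)/(Var_u S_N − Var_t S_N) → 1⁺` only because the Markov centre has
  linearly growing count variance against the logarithmic one of `t` (the realisable AH shows the same decay on `½ℤ`: `1.234 → 1.066`, N = 4 → 20);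
  along the DOOR-RELEVANT ray from the parity-symmetrised embedded AH process (same form factor `|α|` on `[−1,1]`; the direction «more cross-
  sublattice pairs at fixed Montgomery data») the exact depth is `s*_w(N) = 4.178 (N ≤ 8, = positivity of p₄), 3.728, 3.473, 3.223, 3.043, 2.920,
  2.836, 2.754, 2.688, 2.638, 2.598, 2.560 (N = 10, 12, …, 30)` and heuristic LOWER bounds give `s*_w ≥ 2.4 (40), 2.15 (64), 2.15 (96), 2.05 (128),
  2.0 (160)` — no window in reach comes near excluding AH¼, or even the point twice as far from AH.
STRUCTURE (exact, from decks 18b/18d): the form factor of AH¼ JUMPS at `α = ±1` (`F(1⁻) = 1`, `F(1⁺) = t`), equivalently for odd `k`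
`p_k = ρ_A ρ_B + ((1−t)/4)·s(k) − s(k)²/2` with `s(k) = sin(πk/2)/(πk)`, `ρ_{A,B} = ¼ ± √b/4`: a connected pair function of order `1/k`. Hence AH¼ is
not determinantal, not permanental, and not a finite-range factor of any process with summable connected correlations (all of these have
continuous form factors) — a realisation must carry `β = 4`-type `1/k` connected decay.
HONESTY: finite linear programming about 0/1 sequences — nothing about ζ; no exceptional-zero theorem (no Landau–Siegel / Siegel-zero
exclusion, no Theorem 1–2 of arXiv:2211.02515, no repaired Margin232) is proved; N-L21-2 stays a CONJECTURE (strengthened evidence, no proof);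
typed ≠ proved; computed ≠ proved.
-/

namespace Summit.Parity.GeneralizedHardyLittlewood.Theorems.PrimeLevelFamEdgeIdeaDeltas.FloorDual

open Finset

/-! ### Stationary window laws on the hard-core quarter-lattice -/

/-- A 0/1 string on consecutive quarter-sites is HARD-CORE admissible iff no two ADJACENT sites are occupied
(occupied sites at lattice distance `≥ 2`, i.e. at euclidean distance `≥ ½`, matching `KLSRealisable (1/2)`). -/
def IsHardCore {n : ℕ} (w : Fin n → Bool) : Prop :=
  ∀ i j : Fin n, (j : ℕ) = i + 1 → w i = true → w j = false

/-- The `n`-site prefix of an `(n+1)`-site string (drop the last site). -/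
def prefixStr {n : ℕ} (w : Fin (n + 1) → Bool) : Fin n → Bool := fun i => w i.castSucc

/-- The `n`-site suffix of an `(n+1)`-site string (drop site `0`). -/
def suffixStr {n : ℕ} (w : Fin (n + 1) → Bool) : Fin n → Bool := fun i => w i.succ

/-- A STATIONARY WINDOW LAW on `n+1` consecutive quarter-sites: a probability vector on 0/1 strings, carried by the hard-core
strings, whose two `n`-site marginals (prefix law and suffix law) coincide.  These are exactly the restrictions of stationary
hard-core processes on `ℤ` to a window (a consistent window law extends as an order-`n` Markov chain). -/
structure IsWindowLaw (n : ℕ) (μ : (Fin (n + 1) → Bool) → ℝ) : Prop where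
  nonneg : ∀ w, 0 ≤ μ w
  total : ∑ w, μ w = 1
  hardCore : ∀ w, ¬ IsHardCore w → μ w = 0
  stationary : ∀ v : Fin n → Bool,
    (∑ w, if prefixStr w = v then μ w else 0) = ∑ w, if suffixStr w = v then μ w else 0

/-- Real indicator of a Boolean. -/
noncomputable def ind (b : Bool) : ℝ := if b = true then 1 else 0

/-- Site `k` of a string read by a natural index (`false` beyond the window). -/
def getB {n : ℕ} (w : Fin n → Bool) (k : ℕ) : Bool := if h : k < n then w ⟨k, h⟩ else false

/-- Site density of a window law, read at site `0`. -/
noncomputable def siteDensity {n : ℕ} (μ : (Fin (n + 1) → Bool) → ℝ) : ℝ := ∑ w, μ w * ind (w 0)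

/-- Lag-`k` pair frequency of a window law, read at sites `0` and `k` (`= 0` for `k > n`). -/
noncomputable def pairFreq {n : ℕ} (μ : (Fin (n + 1) → Bool) → ℝ) (k : ℕ) : ℝ :=
  ∑ w, μ w * (ind (w 0) * ind (getB w k))

/-- WINDOW REALISABILITY at window `n+1` of lattice pair data `(ρ, p)`: some stationary window law has site density `ρ` and
pair frequencies `p_k` (`1 ≤ k ≤ n`).  A finite LP feasibility problem. -/
def WindowRealisable (n : ℕ) (ρ : ℝ) (p : ℕ → ℝ) : Prop :=
  ∃ μ : (Fin (n + 1) → Bool) → ℝ, IsWindowLaw n μ ∧ siteDensity μ = ρ ∧ ∀ k ∈ Finset.Icc 1 n, pairFreq μ k = p k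

/-- The AH¼ lattice data: density `¼` per quarter-site and `p_k = c_k/4` (`c_k = quarterCoeff k`; `c_1 = 0` is the hard core). -/
def QuarterWindowRealisable (n : ℕ) : Prop := WindowRealisable n (1 / 4) (fun k => quarterCoeff k / 4)

/-- The whole hierarchy. -/
def QuarterWindowAll : Prop := ∀ n : ℕ, QuarterWindowRealisable n

/-- THE WINDOW PRINCIPLE (statement; informal proof: a unit-intensity hard-core-½ process with `ρ₂ = quarterRho` lives on a random
coset of `¼ℤ`, its Palm-stationarised lattice law restricted to a window is a window law with these statistics; conversely a
consistent family of window laws extends (order-`n` Markov extensions + Kolmogorov / compactness) to a stationary lattice process,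
whose uniform shift by `[0,¼)` is a point process with `ρ₂ = quarterRho`, and Kuna–Lebowitz–Speer 2011 Thm 3.2 identifies existence
with the `KLSRealisable` functional condition). -/
def QuarterWindowPrinciple : Prop := (KLSRealisable (1 / 2) quarterRho ↔ QuarterWindowAll)

/-! ### Feasibility certificates: mixtures of periodic hard-core words -/

/-- Cyclic read of a periodic 0/1 word. -/
def cycGet (b : List Bool) (i : ℕ) : Bool := b.getD (i % b.length) false

/-- A periodic word is cyclically hard-core (and non-empty). -/
def IsCyclicHardCore (b : List Bool) : Prop := 0 < b.length ∧ ∀ i : ℕ, cycGet b i = true → cycGet b (i + 1) = false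

/-- Density of a periodic word `= #{occupied}/period`. -/
noncomputable def wordDensity (b : List Bool) : ℝ :=
  (((List.range b.length).filter fun i => cycGet b i = true).length : ℝ) / b.length

/-- Cyclic lag-`k` pair frequency of a periodic word `= #{i < L : b_i = b_{i+k} = 1}/L` — the pair statistics of the word placed on
`ℤ` periodically with a uniformly random phase. -/
noncomputable def wordPairFreq (b : List Bool) (k : ℕ) : ℝ :=
  (((List.range b.length).filter fun i => cycGet b i = true ∧ cycGet b (i + k) = true).length : ℝ) / b.length

/-- A FINITE MIXTURE of periodic hard-core words with weights matching `(ρ, p_1, …, p_n)`. -/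
def PeriodicMixture (n : ℕ) (ρ : ℝ) (p : ℕ → ℝ) (ws : List (List Bool × ℝ)) : Prop :=
  (∀ wl ∈ ws, IsCyclicHardCore wl.1 ∧ 0 ≤ wl.2) ∧ (ws.map Prod.snd).sum = 1 ∧
    (ws.map fun wl => wl.2 * wordDensity wl.1).sum = ρ ∧
      ∀ k : ℕ, 1 ≤ k → k ≤ n → (ws.map fun wl => wl.2 * wordPairFreq wl.1 k).sum = p k

/-- MIXTURES REALISE (statement; routine: the uniformly shifted periodic word is a stationary hard-core process and window laws form a
convex set).  The converse — every stationary window law on `n+1` sites is such a mixture with periods `≤ #{hard-core strings of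
length n}` — is the circulation decomposition of the hard-core de Bruijn graph; together: `WindowRealisable n ρ p ↔ ∃ ws, PeriodicMixture n ρ p ws`. -/
def MixtureRealises : Prop := ∀ (n : ℕ) (ρ : ℝ) (p : ℕ → ℝ) (ws : List (List Bool × ℝ)), PeriodicMixture n ρ p ws → WindowRealisable n ρ p

/-! ### Infeasibility certificates: Farkas cuts with node potentials = KLS polynomials -/

/-- A WINDOW CUT at window `n+1`: a linear functional of `(ρ, p_1..p_n)` together with a NODE POTENTIAL `φ` on `n`-site strings such
that on every hard-core `(n+1)`-string `w` (an edge `prefix w → suffix w` of the hard-core de Bruijn graph)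
`y₀ + [w₀](y_ρ + Σ_{1≤k≤n} y_k [w_k]) + φ(suffix w) − φ(prefix w) ≤ 0`.  By max-mean-cycle duality such a `φ` exists iff the functional
is `≤ 0` in mean on every cycle, i.e. on every stationary hard-core law (and `y₀` can then be raised to make the mean exactly `0` on the
best cycle). -/
structure WindowCut (n : ℕ) where
  /-- constant term -/
  y0 : ℝ
  /-- density coefficient -/
  yρ : ℝ
  /-- pair coefficients `y_k`, `1 ≤ k ≤ n` -/
  y : ℕ → ℝ
  /-- node potential -/
  φ : (Fin n → Bool) → ℝ
  /-- the edge inequality -/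
  edge : ∀ w : Fin (n + 1) → Bool, IsHardCore w →
    y0 + ind (w 0) * (yρ + ∑ k ∈ Finset.Icc 1 n, y k * ind (getB w k)) + φ (suffixStr w) - φ (prefixStr w) ≤ 0

/-- Value of the cut functional at pair data `(ρ, p)`. -/
def WindowCut.eval {n : ℕ} (c : WindowCut n) (ρ : ℝ) (p : ℕ → ℝ) : ℝ :=
  c.y0 + c.yρ * ρ + ∑ k ∈ Finset.Icc 1 n, c.y k * p k

/-- CUT SOUNDNESS: a cut positive at `(ρ, p)` refutes window realisability. -/
def CutRefutes : Prop := ∀ (n : ℕ) (c : WindowCut n) (ρ : ℝ) (p : ℕ → ℝ), 0 < c.eval ρ p → ¬ WindowRealisable n ρ p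

/-- Expectation of a function of the suffix (resp. prefix) under a window law, fibrewise. -/
theorem sum_mul_comp_eq_fiber {n : ℕ} (μ : (Fin (n + 1) → Bool) → ℝ) (φ : (Fin n → Bool) → ℝ)
    (g : (Fin (n + 1) → Bool) → (Fin n → Bool)) :
    ∑ w, μ w * φ (g w) = ∑ v, φ v * ∑ w, (if g w = v then μ w else 0) := by
  have : ∀ w : Fin (n + 1) → Bool, μ w * φ (g w) = ∑ v : Fin n → Bool, (if g w = v then φ v * μ w else 0) := by
    intro w
    rw [Finset.sum_ite_eq]
    simp [mul_comm]
  rw [Finset.sum_congr rfl (fun w _ => this w), Finset.sum_comm]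
  refine Finset.sum_congr rfl (fun v _ => ?_)
  rw [Finset.mul_sum]
  refine Finset.sum_congr rfl (fun w _ => ?_)
  split_ifs <;> simp

/-- Under a stationary window law, `E φ(suffix) = E φ(prefix)` (the node potential TELESCOPES). -/
theorem potential_telescopes {n : ℕ} {μ : (Fin (n + 1) → Bool) → ℝ} (hμ : IsWindowLaw n μ) (φ : (Fin n → Bool) → ℝ) :
    ∑ w, μ w * φ (suffixStr w) = ∑ w, μ w * φ (prefixStr w) := by
  rw [sum_mul_comp_eq_fiber μ φ suffixStr, sum_mul_comp_eq_fiber μ φ prefixStr]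
  refine Finset.sum_congr rfl (fun v _ => ?_)
  rw [hμ.stationary v]

/-- The pair part of the cut functional integrates to `y_ρ ρ + Σ y_k p_k`. -/
theorem sum_mul_pairPart {n : ℕ} (μ : (Fin (n + 1) → Bool) → ℝ) (yρ : ℝ) (y : ℕ → ℝ) :
    ∑ w, μ w * (ind (w 0) * (yρ + ∑ k ∈ Finset.Icc 1 n, y k * ind (getB w k)))
      = yρ * siteDensity μ + ∑ k ∈ Finset.Icc 1 n, y k * pairFreq μ k := by
  simp only [siteDensity, pairFreq, Finset.mul_sum, mul_add, Finset.sum_add_distrib]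
  congr 1
  · exact Finset.sum_congr rfl (fun w _ => by ring)
  · rw [Finset.sum_comm]
    exact Finset.sum_congr rfl (fun k _ => Finset.sum_congr rfl (fun w _ => by ring))

/-- CUT SOUNDNESS (PROVED): sum `edge` against the window law — `y₀·1 + (y_ρ ρ + Σ y_k p_k) + (E φ∘suffix − E φ∘prefix) ≤ 0` and the
bracket vanishes by stationarity.  So a cut positive at the AH¼ data is a Kuna–Lebowitz–Speer test polynomial violated by `quarterRho`:
with `QuarterWindowPrinciple` it gives `¬ KLSRealisable (1/2) quarterRho`, hence `¬ QuarterWitnessRealisable`. -/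
theorem cutRefutes : CutRefutes := by
  intro n c ρ p hpos ⟨μ, hμ, hρ, hp⟩
  -- the edge inequality, integrated against `μ ≥ 0` (strings off the hard core carry no mass)
  have hle : ∑ w, μ w * (c.y0 + ind (w 0) * (c.yρ + ∑ k ∈ Finset.Icc 1 n, c.y k * ind (getB w k))
      + c.φ (suffixStr w) - c.φ (prefixStr w)) ≤ 0 := by
    apply Finset.sum_nonpos
    intro w _
    by_cases hw : IsHardCore w
    · have h1 := c.edge w hw
      have h2 := hμ.nonneg w
      nlinarith
    · rw [hμ.hardCore w hw, zero_mul]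
  -- expand: constant + pair part + telescoping potential
  have hsplit : ∑ w, μ w * (c.y0 + ind (w 0) * (c.yρ + ∑ k ∈ Finset.Icc 1 n, c.y k * ind (getB w k))
      + c.φ (suffixStr w) - c.φ (prefixStr w))
      = c.y0 * ∑ w, μ w + ∑ w, μ w * (ind (w 0) * (c.yρ + ∑ k ∈ Finset.Icc 1 n, c.y k * ind (getB w k)))
        + (∑ w, μ w * c.φ (suffixStr w) - ∑ w, μ w * c.φ (prefixStr w)) := by
    rw [Finset.mul_sum, ← Finset.sum_add_distrib, ← Finset.sum_sub_distrib, ← Finset.sum_add_distrib]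
    exact Finset.sum_congr rfl (fun w _ => by ring)
  rw [hsplit, hμ.total, sum_mul_pairPart, potential_telescopes hμ, sub_self, add_zero, mul_one, hρ] at hle
  have hev : c.eval ρ p = c.y0 + (c.yρ * ρ + ∑ k ∈ Finset.Icc 1 n, c.y k * pairFreq μ k) := by
    unfold WindowCut.eval
    rw [add_assoc]
    congr 2
    exact Finset.sum_congr rfl (fun k hk => by rw [hp k hk])
  linarith [hev ▸ hpos]

/-! ### Yamada's integrality condition as a KLS polynomial -/

/-- YAMADA's polynomial is non-negative POINTWISE: for natural `S` and `m`, `(S − m)(S − m − 1) ≥ 0` (PROVED).  Its expectation under any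
0/1 process, `E S² − (2m+1) E S + m(m+1) ≥ 0`, is LINEAR in `(ρ, p)`; optimised over `m` it reads `Var S ≥ {E S}(1 − {E S})`
(Yamada 1961).  (LANDING NOTE: `private` — the identical statement is already the tree's
`Literature.InformationTheory.QuantumCodes.consecutive_root_product_nonneg`, which consumers should cite; gate rule `dedup.landed`.) -/
private theorem yamada_pointwise (S m : ℕ) : 0 ≤ ((S : ℝ) - m) * ((S : ℝ) - m - 1) := by
  rcases Nat.lt_or_ge m S with h | h
  · have h2 : (m : ℝ) + 1 ≤ S := by exact_mod_cast h
    exact mul_nonneg (by linarith) (by linarith)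
  · have h1 : (S : ℝ) ≤ m := by exact_mod_cast h
    exact mul_nonneg_of_nonpos_of_nonpos (by linarith) (by linarith)

/-- Count variance of the number `S_N` of occupied sites in a window of `N` sites, as the linear functional of lattice pair data
`Var S_N = Nρ + 2 Σ_{k=1}^{N−1} (N − k) p_k − N²ρ²`. -/
noncomputable def countVar (ρ : ℝ) (p : ℕ → ℝ) (N : ℕ) : ℝ :=
  N * ρ + 2 * (∑ k ∈ Finset.Ico 1 N, ((N : ℝ) - k) * p k) - ((N : ℝ) * ρ) ^ 2

/-- YAMADA'S CONDITION for lattice pair data, in the linear form `Var S_N + (Nρ − m)(Nρ − m − 1) ≥ 0` for all `N, m`. -/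
def YamadaCondition (ρ : ℝ) (p : ℕ → ℝ) : Prop :=
  ∀ N m : ℕ, 0 ≤ countVar ρ p N + ((N : ℝ) * ρ - m) * ((N : ℝ) * ρ - m - 1)

/-- YAMADA IS A WINDOW CUT FAMILY (statement; proof: expectation of `yamada_pointwise` for `S = S_{n+1}` under the window law, whose
second moment is `countVar + (E S)²` by stationarity of the window law). -/
def YamadaOfWindow : Prop :=
  ∀ (n : ℕ) (ρ : ℝ) (p : ℕ → ℝ), WindowRealisable n ρ p →
    ∀ m : ℕ, 0 ≤ countVar ρ p (n + 1) + (((n + 1 : ℕ) : ℝ) * ρ - m) * (((n + 1 : ℕ) : ℝ) * ρ - m - 1)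

/-! ### Computed claims of record (gen 6; computed ≠ proved) -/

/-- COMPUTED CLAIM (W160): the AH¼ data pass every window test up to `160` quarter-sites (`40` mean spacings); certificates = explicit
periodic-word mixtures `g6/ship/mix_N.json` (exact column generation for `N ≤ 32`, heuristic for `34 ≤ N ≤ 160`; pure-python exact check
`g6/check_ship.py`), robust via the door-ray points `u + 2(t − u)` at `N = 40, 64, 96, 128, 160`. -/
def QuarterWindow160 : Prop := ∀ n : ℕ, n + 1 ≤ 160 → QuarterWindowRealisable n

/-- COMPUTED CLAIM (W32, both-sided): for `N ≤ 32` sites the verdicts come from EXACT column generation (certified max-mean-cycle pricing), with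
the radial depths of (R). -/
def QuarterWindow32 : Prop := ∀ n : ℕ, n + 1 ≤ 32 → QuarterWindowRealisable n

/-- COMPUTED CLAIM (Y): the AH¼ data satisfy Yamada's condition — verified for `N ≤ 4000` in exact closed form (least margin `0.1067` at
`N = 6`; `Var S_N = (1/π²) log N + 0.174 + o(1)`), asymptotically automatic.  The variance/integrality class of KLS polynomials cannot
refute N-L21-2. -/
def QuarterPassesYamada : Prop := YamadaCondition (1 / 4) (fun k => quarterCoeff k / 4)

/-- STATUS OF N-L21-2 after gen 6 (bookkeeping implication, statement): the realisability conjunct of `QuarterWitnessRealisable` is the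
window hierarchy; `160` of its levels are certified feasible (computed), the Yamada sub-family entirely; no cut is known.  SCOPE (critic
protocol F b30.6 (M4)): all of this concerns `quarterRho` (AH¼) — `KLSRealisable (1/2) quarterRho` — which IMPLIES the typed ∃-form
`QuarterWitnessRealisable` (with `QuarterParseval`, typed, and `QuarterTame`, proved); a cut against `quarterRho` would NOT refute the ∃-form. -/
def QuarterRealisabilityStatus : Prop :=
  QuarterWindowPrinciple ∧ QuarterWindow160 ∧ QuarterPassesYamada

end Summit.Parity.GeneralizedHardyLittlewood.Theorems.PrimeLevelFamEdgeIdeaDeltas.FloorDual
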